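import Mathlib
import HarnessLib
import Summits.ValiantsHypothesis.ValiantsHypothesis.Theorems.LacunarySymmetroidMatrixDescartesOsculationLawCuspNonMonicCount
import Summits.ValiantsHypothesis.ValiantsHypothesis.Theorems.LacunarySymmetroidMatrixDescartesOsculationLawRankTwoColumnSupport
import Summits.ValiantsHypothesis.ValiantsHypothesis.Theorems.LacunarySymmetroidMatrixDescartesOsculationLawRankLetterSplitsAt

/-!
# ValiantsHypothesis / LacunarySymmetroid — crux `MatrixDescartes` (stmt-ValiantsHypothesis-18050, V1),
# line «osculation-law»: the RANK-THREE column, DEGENERATE HALF (`a₃ = det G₂₂ ≡ 0`)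

For the splitting `(3, s)` the letter is the cubic `a₃b³ + a₂b² + a₁b + a₀` of `OsculationLetter.insertionPoly_rank_card`
(`a₃ = det G₂₂`, `a₂`, `a₁` = sums of principal cofactors, `a₀ = det G`).  This file settles the half where the top
coefficient vanishes IDENTICALLY (`a₃ ≡ 0` as a polynomial in `t`): the letter is then the non-monic QUADRATIC
`a₂b² + a₁b + a₀` (or rank-one-shaped if also `a₂ ≡ 0`), real-rooted at every `t` by
`OsculationLetter.hdisc_of_top_zero_three` (the letter splits at every abscissa, `…RankLetterSplitsAt`), so the
count `OsculationCuspGen.nonmonic_cusp_ncard_le` (p609205) with the symbolic monomial counts of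
`…RankTwoColumnSupport` at the shifted size `s + 1` (supports `a₂ ⊆ (s+1)•E`, `a₁ ⊆ (s+2)•E`, `a₀ ⊆ (s+3)•E`) gives

  `osc_three_s_of_top_zero (s K d S) (hS) (h3 : det G₂₂ ≡ 0) (hfin) : #osc ≤ 5 · K ^ (15 (s + 1) + 12)`.

The generic half (`a₃ ≢ 0`) consumes val-lit-p6's non-monic cubic count and is assembled separately.  Honest
framing: a located half-column of an UNREGISTERED V1 law line with a Descartes ceiling; `OsculationLaw` (all `m`),
`PeelInequality`, `stub_recursion`, `MatrixDescartes`, Conjecture B and `VP ≠ VNP` stay OPEN / NOT proved.  No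
definitions, no named facts; Mathlib + tree osculation files only.
-/

-- `Summit.ValiantsHypothesis.ValiantsHypothesis.…` is the tree's mandated single-conjunct layout (Sub = Summit).
set_option linter.dupNamespace false

noncomputable section

namespace Summit.ValiantsHypothesis.ValiantsHypothesis.Theorems.LacunarySymmetroidMatrixDescartes

open Polynomial Set
open scoped BigOperators Pointwise

namespace OsculationRankThree

open OsculationCusp OsculationTwoK OsculationLetter OsculationRankTwo

-- the proof instantiates `hess_reduce_poly` / `nonmonic_cusp_ncard_le` with the explicit `U`, `V`: slow elaboration.
set_option maxHeartbeats 1600000 in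
/-- **Rank-three column, degenerate half.**  For every `s`, `K`, `d` and every symmetric block pencil
`S : Fin K → Matrix (Fin 3 ⊕ Fin s) (Fin 3 ⊕ Fin s) ℝ` whose lower-right block pencil has `det G₂₂ ≡ 0`: if the
osculation set of `det(Σ_l t^(d l) S_l + b·(I₃ ⊕ 0)) = 0` (the line's `osculationSet d S`, UNFOLDED verbatim) is
finite, it has at most `5 · K^(15 (s + 1) + 12)` points. -/
theorem osc_three_s_of_top_zero (s K : ℕ) (d : Fin K → ℕ) (S : Fin K → Matrix (Fin 3 ⊕ Fin s) (Fin 3 ⊕ Fin s) ℝ)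
    (hS : ∀ l, (S l).IsSymm) (h3 : (∑ l, (X : ℝ[X]) ^ d l • ((S l).toBlocks₂₂).map Polynomial.C).det = 0)
    (hfin : {p : Fin 2 → ℝ | 0 < p 0 ∧ 0 < p 1 ∧ MvPolynomial.eval p (∑ l, (MvPolynomial.X (0 : Fin 2) : MvPolynomial (Fin 2) ℝ) ^ d l •
              (S l).map (MvPolynomial.C : ℝ →+* MvPolynomial (Fin 2) ℝ)
            + (MvPolynomial.X (1 : Fin 2) : MvPolynomial (Fin 2) ℝ) •
              (Matrix.fromBlocks 1 0 0 0 : Matrix (Fin 3 ⊕ Fin s) (Fin 3 ⊕ Fin s) ℝ).map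
                (MvPolynomial.C : ℝ →+* MvPolynomial (Fin 2) ℝ)).det = 0 ∧
      MvPolynomial.eval p
        (MvPolynomial.X 0 * MvPolynomial.pderiv 0 (MvPolynomial.X 0 * MvPolynomial.pderiv 0 (∑ l, (MvPolynomial.X (0 : Fin 2) : MvPolynomial (Fin 2) ℝ) ^ d l •
              (S l).map (MvPolynomial.C : ℝ →+* MvPolynomial (Fin 2) ℝ)
            + (MvPolynomial.X (1 : Fin 2) : MvPolynomial (Fin 2) ℝ) •
              (Matrix.fromBlocks 1 0 0 0 : Matrix (Fin 3 ⊕ Fin s) (Fin 3 ⊕ Fin s) ℝ).map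
                (MvPolynomial.C : ℝ →+* MvPolynomial (Fin 2) ℝ)).det)
            * (MvPolynomial.X 1 * MvPolynomial.pderiv 1 (∑ l, (MvPolynomial.X (0 : Fin 2) : MvPolynomial (Fin 2) ℝ) ^ d l •
              (S l).map (MvPolynomial.C : ℝ →+* MvPolynomial (Fin 2) ℝ)
            + (MvPolynomial.X (1 : Fin 2) : MvPolynomial (Fin 2) ℝ) •
              (Matrix.fromBlocks 1 0 0 0 : Matrix (Fin 3 ⊕ Fin s) (Fin 3 ⊕ Fin s) ℝ).map
                (MvPolynomial.C : ℝ →+* MvPolynomial (Fin 2) ℝ)).det) ^ 2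
          - 2 * (MvPolynomial.X 0 * MvPolynomial.pderiv 0 (MvPolynomial.X 1 * MvPolynomial.pderiv 1 (∑ l, (MvPolynomial.X (0 : Fin 2) : MvPolynomial (Fin 2) ℝ) ^ d l •
              (S l).map (MvPolynomial.C : ℝ →+* MvPolynomial (Fin 2) ℝ)
            + (MvPolynomial.X (1 : Fin 2) : MvPolynomial (Fin 2) ℝ) •
              (Matrix.fromBlocks 1 0 0 0 : Matrix (Fin 3 ⊕ Fin s) (Fin 3 ⊕ Fin s) ℝ).map
                (MvPolynomial.C : ℝ →+* MvPolynomial (Fin 2) ℝ)).det))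
            * (MvPolynomial.X 0 * MvPolynomial.pderiv 0 (∑ l, (MvPolynomial.X (0 : Fin 2) : MvPolynomial (Fin 2) ℝ) ^ d l •
              (S l).map (MvPolynomial.C : ℝ →+* MvPolynomial (Fin 2) ℝ)
            + (MvPolynomial.X (1 : Fin 2) : MvPolynomial (Fin 2) ℝ) •
              (Matrix.fromBlocks 1 0 0 0 : Matrix (Fin 3 ⊕ Fin s) (Fin 3 ⊕ Fin s) ℝ).map
                (MvPolynomial.C : ℝ →+* MvPolynomial (Fin 2) ℝ)).det) * (MvPolynomial.X 1 * MvPolynomial.pderiv 1 (∑ l, (MvPolynomial.X (0 : Fin 2) : MvPolynomial (Fin 2) ℝ) ^ d l •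
              (S l).map (MvPolynomial.C : ℝ →+* MvPolynomial (Fin 2) ℝ)
            + (MvPolynomial.X (1 : Fin 2) : MvPolynomial (Fin 2) ℝ) •
              (Matrix.fromBlocks 1 0 0 0 : Matrix (Fin 3 ⊕ Fin s) (Fin 3 ⊕ Fin s) ℝ).map
                (MvPolynomial.C : ℝ →+* MvPolynomial (Fin 2) ℝ)).det)
          + MvPolynomial.X 1 * MvPolynomial.pderiv 1 (MvPolynomial.X 1 * MvPolynomial.pderiv 1 (∑ l, (MvPolynomial.X (0 : Fin 2) : MvPolynomial (Fin 2) ℝ) ^ d l •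
              (S l).map (MvPolynomial.C : ℝ →+* MvPolynomial (Fin 2) ℝ)
            + (MvPolynomial.X (1 : Fin 2) : MvPolynomial (Fin 2) ℝ) •
              (Matrix.fromBlocks 1 0 0 0 : Matrix (Fin 3 ⊕ Fin s) (Fin 3 ⊕ Fin s) ℝ).map
                (MvPolynomial.C : ℝ →+* MvPolynomial (Fin 2) ℝ)).det)
            * (MvPolynomial.X 0 * MvPolynomial.pderiv 0 (∑ l, (MvPolynomial.X (0 : Fin 2) : MvPolynomial (Fin 2) ℝ) ^ d l •
              (S l).map (MvPolynomial.C : ℝ →+* MvPolynomial (Fin 2) ℝ)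
            + (MvPolynomial.X (1 : Fin 2) : MvPolynomial (Fin 2) ℝ) •
              (Matrix.fromBlocks 1 0 0 0 : Matrix (Fin 3 ⊕ Fin s) (Fin 3 ⊕ Fin s) ℝ).map
                (MvPolynomial.C : ℝ →+* MvPolynomial (Fin 2) ℝ)).det) ^ 2) = 0}.Finite) :
    {p : Fin 2 → ℝ | 0 < p 0 ∧ 0 < p 1 ∧ MvPolynomial.eval p (∑ l, (MvPolynomial.X (0 : Fin 2) : MvPolynomial (Fin 2) ℝ) ^ d l •
              (S l).map (MvPolynomial.C : ℝ →+* MvPolynomial (Fin 2) ℝ)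
            + (MvPolynomial.X (1 : Fin 2) : MvPolynomial (Fin 2) ℝ) •
              (Matrix.fromBlocks 1 0 0 0 : Matrix (Fin 3 ⊕ Fin s) (Fin 3 ⊕ Fin s) ℝ).map
                (MvPolynomial.C : ℝ →+* MvPolynomial (Fin 2) ℝ)).det = 0 ∧
      MvPolynomial.eval p
        (MvPolynomial.X 0 * MvPolynomial.pderiv 0 (MvPolynomial.X 0 * MvPolynomial.pderiv 0 (∑ l, (MvPolynomial.X (0 : Fin 2) : MvPolynomial (Fin 2) ℝ) ^ d l •
              (S l).map (MvPolynomial.C : ℝ →+* MvPolynomial (Fin 2) ℝ)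
            + (MvPolynomial.X (1 : Fin 2) : MvPolynomial (Fin 2) ℝ) •
              (Matrix.fromBlocks 1 0 0 0 : Matrix (Fin 3 ⊕ Fin s) (Fin 3 ⊕ Fin s) ℝ).map
                (MvPolynomial.C : ℝ →+* MvPolynomial (Fin 2) ℝ)).det)
            * (MvPolynomial.X 1 * MvPolynomial.pderiv 1 (∑ l, (MvPolynomial.X (0 : Fin 2) : MvPolynomial (Fin 2) ℝ) ^ d l •
              (S l).map (MvPolynomial.C : ℝ →+* MvPolynomial (Fin 2) ℝ)
            + (MvPolynomial.X (1 : Fin 2) : MvPolynomial (Fin 2) ℝ) •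
              (Matrix.fromBlocks 1 0 0 0 : Matrix (Fin 3 ⊕ Fin s) (Fin 3 ⊕ Fin s) ℝ).map
                (MvPolynomial.C : ℝ →+* MvPolynomial (Fin 2) ℝ)).det) ^ 2
          - 2 * (MvPolynomial.X 0 * MvPolynomial.pderiv 0 (MvPolynomial.X 1 * MvPolynomial.pderiv 1 (∑ l, (MvPolynomial.X (0 : Fin 2) : MvPolynomial (Fin 2) ℝ) ^ d l •
              (S l).map (MvPolynomial.C : ℝ →+* MvPolynomial (Fin 2) ℝ)
            + (MvPolynomial.X (1 : Fin 2) : MvPolynomial (Fin 2) ℝ) •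
              (Matrix.fromBlocks 1 0 0 0 : Matrix (Fin 3 ⊕ Fin s) (Fin 3 ⊕ Fin s) ℝ).map
                (MvPolynomial.C : ℝ →+* MvPolynomial (Fin 2) ℝ)).det))
            * (MvPolynomial.X 0 * MvPolynomial.pderiv 0 (∑ l, (MvPolynomial.X (0 : Fin 2) : MvPolynomial (Fin 2) ℝ) ^ d l •
              (S l).map (MvPolynomial.C : ℝ →+* MvPolynomial (Fin 2) ℝ)
            + (MvPolynomial.X (1 : Fin 2) : MvPolynomial (Fin 2) ℝ) •
              (Matrix.fromBlocks 1 0 0 0 : Matrix (Fin 3 ⊕ Fin s) (Fin 3 ⊕ Fin s) ℝ).map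
                (MvPolynomial.C : ℝ →+* MvPolynomial (Fin 2) ℝ)).det) * (MvPolynomial.X 1 * MvPolynomial.pderiv 1 (∑ l, (MvPolynomial.X (0 : Fin 2) : MvPolynomial (Fin 2) ℝ) ^ d l •
              (S l).map (MvPolynomial.C : ℝ →+* MvPolynomial (Fin 2) ℝ)
            + (MvPolynomial.X (1 : Fin 2) : MvPolynomial (Fin 2) ℝ) •
              (Matrix.fromBlocks 1 0 0 0 : Matrix (Fin 3 ⊕ Fin s) (Fin 3 ⊕ Fin s) ℝ).map
                (MvPolynomial.C : ℝ →+* MvPolynomial (Fin 2) ℝ)).det)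
          + MvPolynomial.X 1 * MvPolynomial.pderiv 1 (MvPolynomial.X 1 * MvPolynomial.pderiv 1 (∑ l, (MvPolynomial.X (0 : Fin 2) : MvPolynomial (Fin 2) ℝ) ^ d l •
              (S l).map (MvPolynomial.C : ℝ →+* MvPolynomial (Fin 2) ℝ)
            + (MvPolynomial.X (1 : Fin 2) : MvPolynomial (Fin 2) ℝ) •
              (Matrix.fromBlocks 1 0 0 0 : Matrix (Fin 3 ⊕ Fin s) (Fin 3 ⊕ Fin s) ℝ).map
                (MvPolynomial.C : ℝ →+* MvPolynomial (Fin 2) ℝ)).det)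
            * (MvPolynomial.X 0 * MvPolynomial.pderiv 0 (∑ l, (MvPolynomial.X (0 : Fin 2) : MvPolynomial (Fin 2) ℝ) ^ d l •
              (S l).map (MvPolynomial.C : ℝ →+* MvPolynomial (Fin 2) ℝ)
            + (MvPolynomial.X (1 : Fin 2) : MvPolynomial (Fin 2) ℝ) •
              (Matrix.fromBlocks 1 0 0 0 : Matrix (Fin 3 ⊕ Fin s) (Fin 3 ⊕ Fin s) ℝ).map
                (MvPolynomial.C : ℝ →+* MvPolynomial (Fin 2) ℝ)).det) ^ 2) = 0}.ncard ≤ 5 * K ^ (15 * (s + 1) + 12) := by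

  classical
  have hEK : (Finset.univ.image d).card ≤ K := (Finset.card_image_le).trans (by simp)
  obtain ⟨h27, h10⟩ := column_arith K (s + 1)
  -- the letter with vanishing top coefficient: `Φ = X₁X₁·ι a₂ + X₁·ι a₁ + ι(det G)`
  have hΦ : (∑ l, (MvPolynomial.X (0 : Fin 2) : MvPolynomial (Fin 2) ℝ) ^ d l •
              (S l).map (MvPolynomial.C : ℝ →+* MvPolynomial (Fin 2) ℝ)
            + (MvPolynomial.X (1 : Fin 2) : MvPolynomial (Fin 2) ℝ) •
              (Matrix.fromBlocks 1 0 0 0 : Matrix (Fin 3 ⊕ Fin s) (Fin 3 ⊕ Fin s) ℝ).map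
                (MvPolynomial.C : ℝ →+* MvPolynomial (Fin 2) ℝ)).det =
      MvPolynomial.X 1 * MvPolynomial.X 1 * Polynomial.aeval (MvPolynomial.X 0 : MvPolynomial (Fin 2) ℝ)
          (∑ U ∈ (Finset.univ.map Function.Embedding.inl : Finset (Fin 3 ⊕ Fin s)).powersetCard 2,
          (Matrix.of fun i j : Fin 3 ⊕ Fin s => if i ∈ U then (Pi.single i (1 : ℝ[X]) : Fin 3 ⊕ Fin s → ℝ[X]) j
            else (∑ l, (X : ℝ[X]) ^ d l • (S l).map Polynomial.C) i j).det)
        + MvPolynomial.X 1 * Polynomial.aeval (MvPolynomial.X 0 : MvPolynomial (Fin 2) ℝ)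
          (∑ U ∈ (Finset.univ.map Function.Embedding.inl : Finset (Fin 3 ⊕ Fin s)).powersetCard 1,
          (Matrix.of fun i j : Fin 3 ⊕ Fin s => if i ∈ U then (Pi.single i (1 : ℝ[X]) : Fin 3 ⊕ Fin s → ℝ[X]) j
            else (∑ l, (X : ℝ[X]) ^ d l • (S l).map Polynomial.C) i j).det)
        + Polynomial.aeval (MvPolynomial.X 0 : MvPolynomial (Fin 2) ℝ) (∑ l, (X : ℝ[X]) ^ d l • (S l).map Polynomial.C).det := by
    rw [insertionPoly_rank_card 3 s d S, Finset.sum_range_succ, Finset.sum_range_succ, Finset.sum_range_succ,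
      Finset.sum_range_succ, Finset.sum_range_zero, coeff_top 3 s d S, coeff_zero 3 s d S, h3, map_zero]
    ring
  have ha2s : (∑ U ∈ (Finset.univ.map Function.Embedding.inl : Finset (Fin 3 ⊕ Fin s)).powersetCard 2,
          (Matrix.of fun i j : Fin 3 ⊕ Fin s => if i ∈ U then (Pi.single i (1 : ℝ[X]) : Fin 3 ⊕ Fin s → ℝ[X]) j
            else (∑ l, (X : ℝ[X]) ^ d l • (S l).map Polynomial.C) i j).det).support ⊆ (s + 1) • Finset.univ.image d :=
    supp_cast (supp_coeff_card 3 s d S 2) (by omega)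
  have ha1s : (∑ U ∈ (Finset.univ.map Function.Embedding.inl : Finset (Fin 3 ⊕ Fin s)).powersetCard 1,
          (Matrix.of fun i j : Fin 3 ⊕ Fin s => if i ∈ U then (Pi.single i (1 : ℝ[X]) : Fin 3 ⊕ Fin s → ℝ[X]) j
            else (∑ l, (X : ℝ[X]) ^ d l • (S l).map Polynomial.C) i j).det).support ⊆ (s + 1 + 1) • Finset.univ.image d :=
    supp_cast (supp_coeff_card 3 s d S 1) (by omega)
  have hδ : ((∑ l, (X : ℝ[X]) ^ d l • (S l).map Polynomial.C).det).support ⊆ (s + 1 + 2) • Finset.univ.image d :=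
    supp_cast (supp_det_pencil d S) (by simp [Fintype.card_sum, Fintype.card_fin]; omega)
  by_cases ha2 : (∑ U ∈ (Finset.univ.map Function.Embedding.inl : Finset (Fin 3 ⊕ Fin s)).powersetCard 2,
          (Matrix.of fun i j : Fin 3 ⊕ Fin s => if i ∈ U then (Pi.single i (1 : ℝ[X]) : Fin 3 ⊕ Fin s → ℝ[X]) j
            else (∑ l, (X : ℝ[X]) ^ d l • (S l).map Polynomial.C) i j).det) = 0
  · -- rank-one shape `Φ = ι(det G) + X₁·ι a₁`
    have hΦ' : (∑ l, (MvPolynomial.X (0 : Fin 2) : MvPolynomial (Fin 2) ℝ) ^ d l •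
              (S l).map (MvPolynomial.C : ℝ →+* MvPolynomial (Fin 2) ℝ)
            + (MvPolynomial.X (1 : Fin 2) : MvPolynomial (Fin 2) ℝ) •
              (Matrix.fromBlocks 1 0 0 0 : Matrix (Fin 3 ⊕ Fin s) (Fin 3 ⊕ Fin s) ℝ).map
                (MvPolynomial.C : ℝ →+* MvPolynomial (Fin 2) ℝ)).det =
        Polynomial.aeval (MvPolynomial.X 0 : MvPolynomial (Fin 2) ℝ) (∑ l, (X : ℝ[X]) ^ d l • (S l).map Polynomial.C).det
          + MvPolynomial.X 1 * Polynomial.aeval (MvPolynomial.X 0 : MvPolynomial (Fin 2) ℝ)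
            (∑ U ∈ (Finset.univ.map Function.Embedding.inl : Finset (Fin 3 ⊕ Fin s)).powersetCard 1,
          (Matrix.of fun i j : Fin 3 ⊕ Fin s => if i ∈ U then (Pi.single i (1 : ℝ[X]) : Fin 3 ⊕ Fin s → ℝ[X]) j
            else (∑ l, (X : ℝ[X]) ^ d l • (S l).map Polynomial.C) i j).det) := by
      rw [hΦ, ha2, map_zero, mul_zero, zero_add, add_comm]
    refine (OsculationRankOne.osc_ncard_le _ _ _ hΦ' hfin).trans ?_
    refine (OsculationRankOne.card_roots_filter_pos_le_card_support _).trans ?_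
    exact ((card_support_le_of_subset_nsmul (supp_R_gen _ _ _ (s + 1) hδ ha1s)).trans
      (Nat.pow_le_pow_left hEK _)).trans h10
  · have hcount := OsculationCuspGen.nonmonic_cusp_ncard_le _ _ _ _ _ _ hΦ ha2
      (hdisc_of_top_zero_three s d S hS h3)
      (fun t b hΨ => OsculationCuspGen.hess_reduce_poly _ _ _ _ _ t b _ _ _ _ _ _ _ _ _
        rfl rfl rfl rfl rfl rfl rfl rfl rfl rfl rfl hΨ) hfin
    have hN := (card_support_le_of_subset_nsmul (supp_N_gen _ _ _ _ (s + 1) ha2s ha1s hδ)).trans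
      (Nat.pow_le_pow_left hEK _)
    have hU := (card_support_le_of_subset_nsmul (supp_U_gen _ _ _ _ (s + 1) ha2s ha1s hδ)).trans
      (Nat.pow_le_pow_left hEK _)
    have hV := (card_support_le_of_subset_nsmul (supp_V_gen _ _ _ _ (s + 1) ha2s ha1s hδ)).trans
      (Nat.pow_le_pow_left hEK _)
    exact hcount.trans ((Nat.add_le_add (Nat.add_le_add hN (Nat.mul_le_mul_left 2 hU))
      (Nat.mul_le_mul_left 2 hV)).trans h27)

end OsculationRankThree

end Summit.ValiantsHypothesis.ValiantsHypothesis.Theorems.LacunarySymmetroidMatrixDescartes
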